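import Summits.Ventures.CertifiedManyBodySolver.Observables.PairLROOnePointCeilingCert
import Literature.MathematicalPhysics.QuantumLattice.PairFieldCommutatorLocalityTT
import HarnessLib

/-!
# One-point route for the `t–t'` Hubbard model: a certified one-point ceiling at ANY `t'` (e.g. the
# STEP-0 anchor `(U, n, t') = (8, 7/8, −1/4)`) is a ceiling on the pair-field LRO sequence, `liminf u_k ≤ 2M²`

HONEST FRAMING: first certified bounds on pairing observables; not a superconductivity verdict; every
number certified (two lineages + referee) or labelled float. Crew hubbard-obs (D-0042), seat hubbard-obs-p1
(`prover-hubbard-obs-p1-g5-0`). Zero compute; no definition; no named fact; no `sorry`.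

`t–t'` twin of `PairLROOnePointCeiling` / `PairLROOnePointReading` / `PairLROOnePointCeilingCert` (which are
stated for `t' = 0`, `H_L = hubbardTorus 2 L t U`): the only model-specific input of the source-free
Koma–Tasaki / KHvdL argument is the `O(L²)` double-commutator locality constant, now available for
`H^{tt'}_L = hubbardTorusTT' L t t' U` (`exists_norm_expect_doubleCommutator_pairField_le_TT'`,
Literature/…/PairFieldCommutatorLocalityTT); the window-certificate theorem
`re_orbitState_ge_of_window_variational_certificate_d4_TT'_ineq` was `t–t'`-general from the start.

* `onePoint_finite_step_TT'`, **`liminf_pairFieldLRO_le_of_onePoint_variational_bound_TT'`** (any `t, t'`,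
  `U ≥ 0`, `0 ≤ n < 2`, `κ ≥ 0`, `e(t, t', U, n) ≤ u`, any `g`),
  `liminf_pairFieldLRO_le_of_onePoint_orbitState_bound_TT'`,
  **`liminf_pairFieldLRO_le_of_onePoint_variational_certificate_TT'`** (OP1-E identity in `𝔄_{Λ'}` with the
  local energy `E^{t,t'}_Φ` ⇒ `liminf u_k ≤ 2(c − Σ‖a_k‖ + (Σ_σ μ_σ)(n/2 − ν))²`);
* `dWavePairLRO_liminf_le_of_onePoint_variational_certificate_M3` — the registry-style reading at the M3
  points `(U, n) = (8, 7/8)`, ANY `t'` (cap node `M3EnergyUpperRow tp hi`): the conclusion is the explicit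
  summit-format inequality `liminf_k u_k ≤ c'` for every family of unit `(rectN (7/8) L, S^z = 0)`-sector
  ground states of `hubbardTorusTT' L 1 tp 8` (at `tp = 0` this is `M3ObsPairLROCeilingAt_tp0 c'`; no
  `tp`-generic leaf is defined here — HONEST: a leaf is a definition and belongs to the leaves files).

References: T. Koma, H. Tasaki, J. Stat. Phys. 76 (1994) 745, Theorem 2.2 [KomaTasaki1994]; J. Wang et al.,
PRX 14 (2024) 031006, §III [WangEtAl2024]; X. Han, arXiv:2006.06002, §3 [Han2020Bootstrap]; D. J. Scalapino,
Phys. Rep. 250 (1995) 329, §2 eq. (2.4) [Scalapino1995]; H. Xu et al., Science 384 (2024) eadh7691 [XuEtAl2024].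
-/

noncomputable section

namespace Summit.Ventures.CertifiedManyBodySolver.Observables

open Matrix Complex Finset Literature.MathematicalPhysics.QuantumLattice Literature.Probability.LatticeModels
open Literature.MathematicalPhysics.QuantumLattice.HubbardWave0 ThermodynamicLimit Filter Topology
open Literature.MathematicalPhysics.QuantumManyBody.StateRelaxation
open Summit.Ventures.CertifiedManyBodySolver.Transport
open scoped ComplexOrder ComplexConjugate BigOperators

/-! ### §1  One torus -/

section Finite

variable {L : ℕ} [NeZero L] (g : Site 2 → ℝ)

/-- **The finite-volume step, `t–t'` model.** On one torus of side `L`: a unit sector ground state `ψ` (sector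
`(N, S^z = 0)`) of `H = hubbardTorusTT' L t t' U` with LRO floor `c₀ L⁴ ≤ Re⟨ψ, Δ†Δ ψ⟩` (`c₀ > 0`), locality
constants `|Re⟨ψ, [Δ, Δ†] ψ⟩| ≤ C_γ L²`, `‖⟨ψ, [O, [H, O]] ψ⟩‖ ≤ C_δ L²` (`O = Δ + Δ†`), and a one-point
variational bound (OP1) valid for every unit vector of the torus (`κ ≥ 0` not even needed here), give
`√(2c₀ − C_γ/L²)/2 ≤ −(c − A + (Σ_σ μ_σ)((N/2)/L² − ν) + κ(u − E/L²)) + K/L⁴`,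
`E = minEnergyOn (szSector N 0)`, `K = ((Σ|μ_σ|)C_γ/2 + κC_δ/4)/c₀`.
[cite: KomaTasaki1994, Theorem 2.2 (2.9)] [cite: KaplanHorschVonDerLinden1989] -/
theorem onePoint_finite_step_TT' (t t' U : ℝ) {N : ℕ} {ψ : Fock (Orb (FermionTorus 2 L))}
    (hψ1 : star ψ ⬝ᵥ ψ = 1) (hgs : IsGroundStateInSector (hubbardTorusTT' L t t' U) N 0 ψ)
    {c A κ u ν c₀ Cγ Cδ : ℝ} (μ : Fin 2 → ℝ) (hκ : 0 ≤ κ) (hc₀ : 0 < c₀) (hCγ : 0 ≤ Cγ) (hCδ : 0 ≤ Cδ)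
    (hγ : |(expect (pairField g L * (pairField g L)ᴴ - (pairField g L)ᴴ * pairField g L) ψ).re| ≤
      Cγ * (L : ℝ) ^ 2)
    (hδ : ‖expect ((pairField g L + (pairField g L)ᴴ) *
              (hubbardTorusTT' L t t' U * (pairField g L + (pairField g L)ᴴ) -
                (pairField g L + (pairField g L)ᴴ) * hubbardTorusTT' L t t' U) -
            (hubbardTorusTT' L t t' U * (pairField g L + (pairField g L)ᴴ) -
                (pairField g L + (pairField g L)ᴴ) * hubbardTorusTT' L t t' U) *
              (pairField g L + (pairField g L)ᴴ)) ψ‖ ≤ Cδ * (L : ℝ) ^ 2)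
    (hlro : c₀ * (L : ℝ) ^ 4 ≤ (expect ((pairField g L)ᴴ * pairField g L) ψ).re)
    (hbound : ∀ ζ : Fock (Orb (FermionTorus 2 L)), star ζ ⬝ᵥ ζ = 1 →
      c - A + ∑ σ : Fin 2, μ σ *
          ((star ζ ⬝ᵥ ((∑ y : FermionTorus 2 L, numberOp y σ) *ᵥ ζ)).re / (L : ℝ) ^ 2 - ν) +
        κ * (u - (star ζ ⬝ᵥ (hubbardTorusTT' L t t' U *ᵥ ζ)).re / (L : ℝ) ^ 2) ≤
        -((expect (pairField g L) ζ).re / (L : ℝ) ^ 2)) :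
    Real.sqrt (2 * c₀ - Cγ / (L : ℝ) ^ 2) / 2 ≤
      -(c - A + (∑ σ : Fin 2, μ σ) * (((N : ℝ) / 2) / (L : ℝ) ^ 2 - ν) +
          κ * (u - (hubbardTorusTT' L t t' U).minEnergyOn (szSector N 0) / (L : ℝ) ^ 2)) +
        (((∑ σ : Fin 2, |μ σ|) * Cγ / 2 + κ * Cδ / 4) / c₀) / (L : ℝ) ^ 4 := by
  have hHh : (hubbardTorusTT' L t t' U).IsHermitian := hubbardTorusTT'_isHermitian L t t' U
  have hL : (0 : ℝ) < (L : ℝ) := Nat.cast_pos.2 (Nat.pos_of_ne_zero (NeZero.ne L))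
  -- `a² = Re⟨Δ†Δ⟩ + Re⟨ΔΔ†⟩`
  have hNψ : (totalNumber : Matrix (Finset (Orb (FermionTorus 2 L))) _ ℂ) *ᵥ ψ = (((N : ℝ) : ℝ) : ℂ) • ψ := by
    rw [totalNumber_mulVec_of_isNParticle ((mem_szSector_iff _ _ ψ).1 hgs.1).1]
    push_cast
    rfl
  set av : ℝ := eucNorm ((pairField g L + (pairField g L)ᴴ) *ᵥ ψ) with hav
  have hav2eq : av ^ 2 = (expect ((pairField g L)ᴴ * pairField g L) ψ).re +
      (expect (pairField g L * (pairField g L)ᴴ) ψ).re :=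
    eucNorm_sq_add_conjTranspose_mulVec totalNumber_isHermitian (totalNumber_commutator_pairField g L)
      two_ne_zero hNψ
  have hBnonneg : 0 ≤ (expect (pairField g L * (pairField g L)ᴴ) ψ).re :=
    (Complex.nonneg_iff.1
      ((Matrix.posSemidef_self_mul_conjTranspose (pairField g L)).dotProduct_mulVec_nonneg ψ)).1
  have hγ' : |(expect (pairField g L * (pairField g L)ᴴ) ψ).re -
      (expect ((pairField g L)ᴴ * pairField g L) ψ).re| ≤ Cγ * (L : ℝ) ^ 2 := by
    have e : expect (pairField g L * (pairField g L)ᴴ - (pairField g L)ᴴ * pairField g L) ψ =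
        expect (pairField g L * (pairField g L)ᴴ) ψ - expect ((pairField g L)ᴴ * pairField g L) ψ := by
      simp [Literature.MathematicalPhysics.QuantumLattice.expect, sub_mulVec, dotProduct_sub]
    have h := hγ
    rwa [e, Complex.sub_re] at h
  have hav2 : 2 * c₀ * (L : ℝ) ^ 4 - Cγ * (L : ℝ) ^ 2 ≤ av ^ 2 := by
    have h := (abs_le.1 hγ').1
    rw [hav2eq]
    linarith
  have hav2' : c₀ * (L : ℝ) ^ 4 ≤ av ^ 2 := by
    rw [hav2eq]
    linarith
  have hav_pos : 0 < av := by
    have h4 : 0 < c₀ * (L : ℝ) ^ 4 := by positivity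
    have hnn : 0 ≤ av := eucNorm_nonneg _
    rcases hnn.lt_or_eq with hlt | heq
    · exact hlt
    · exfalso
      rw [← heq] at hav2'
      have : c₀ * (L : ℝ) ^ 4 ≤ 0 := by simpa using hav2'
      linarith
  obtain ⟨Ξ, hΞ1, hΞP, hΞH, hΞN⟩ :=
    exists_onePointWitness_numerics g hHh hψ1 hgs hav hav_pos hγ' hδ
  have hwin := hbound Ξ hΞ1
  rw [hΞP, ← neg_div] at hwin
  exact onePoint_real_step μ (fun σ => (star Ξ ⬝ᵥ ((∑ y : FermionTorus 2 L, numberOp y σ) *ᵥ Ξ)).re)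
    hL hav_pos hc₀ hκ hCγ hCδ hav2 hav2' hΞN hΞH hwin

end Finite

/-! ### §2  Families of sector ground states -/

section Family

variable (g : Site 2 → ℝ)

/-- **A certified one-point variational bound is a ceiling on the pair-field LRO sequence, `t–t'` model.**
Let `U ≥ 0`, `0 ≤ n < 2`, `κ ≥ 0`, `e(t, t', U, n) ≤ u`, and suppose the one-point bound (OP1)
`c − A + Σ_σ μ_σ (Re⟨ζ, N_σ ζ⟩/L² − ν) + κ (u − Re⟨ζ, H_L ζ⟩/L²) ≤ −Re⟨ζ, Δ_g ζ⟩/L²` holds for every unit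
vector `ζ` of every torus of side `L ≥ L₁` (`H_L = hubbardTorusTT' L t t' U`). Then for EVERY family `ψ_L` of
unit `(rectN n L, S^z = 0)`-sector ground states the sequence
`u_k = |Λ_{2k}|⁻² Σ_{x,y ∈ Λ_{2k}} P_g(2k; x, y)` obeys
`liminf_k u_k ≤ 2 M²`, `M = −(c − A + (Σ_σ μ_σ)(n/2 − ν))` (written as `2 (c − A + (Σμ)(n/2 − ν))²`).
Koma–Tasaki 1994 Theorem 2.2 with the sourced order parameter replaced by a direct one-point bound over
low-energy number-indefinite states. [cite: KomaTasaki1994, Theorem 2.2] [cite: WangEtAl2024, §III]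
[cite: Scalapino1995, §2 eq. (2.4)] -/
theorem liminf_pairFieldLRO_le_of_onePoint_variational_bound_TT' (t t' : ℝ) {U n : ℝ} (hU : 0 ≤ U)
    (hn0 : 0 ≤ n) (hn2 : n < 2) {c A κ u ν : ℝ} (μ : Fin 2 → ℝ) (hκ : 0 ≤ κ)
    (hu : energyDensityTT' t t' U n ≤ u) (L₁ : ℕ)
    (hbound : ∀ (L : ℕ) [NeZero L], L₁ ≤ L → ∀ ζ : Fock (Orb (FermionTorus 2 L)), star ζ ⬝ᵥ ζ = 1 →
      c - A + ∑ σ : Fin 2, μ σ *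
          ((star ζ ⬝ᵥ ((∑ y : FermionTorus 2 L, numberOp y σ) *ᵥ ζ)).re / (L : ℝ) ^ 2 - ν) +
        κ * (u - (star ζ ⬝ᵥ (hubbardTorusTT' L t t' U *ᵥ ζ)).re / (L : ℝ) ^ 2) ≤
        -((expect (pairField g L) ζ).re / (L : ℝ) ^ 2))
    (ψ : ∀ L, Fock (Orb (FermionTorus 2 L)))
    (hψ : ∀ L, IsGroundStateInSector (hubbardTorusTT' L t t' U) (rectN n L) 0 (ψ L))
    (hψ1 : ∀ L, star (ψ L) ⬝ᵥ ψ L = 1) :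
    liminf (fun k : ℕ => (∑ x ∈ halfOpenBox 2 (2 * k), ∑ y ∈ halfOpenBox 2 (2 * k),
        torusPullback (pairFieldCorr g ψ) (2 * k) x y) / ((#(halfOpenBox 2 (2 * k)) : ℝ)) ^ 2) atTop ≤
      2 * (c - A + (∑ σ : Fin 2, μ σ) * (n / 2 - ν)) ^ 2 := by
  obtain ⟨Cγ, Lγ, hCγ, hγ⟩ := exists_abs_re_expect_commutator_pairField_le g
  obtain ⟨Cδ, Lδ, hCδ, hδ⟩ := exists_norm_expect_doubleCommutator_pairField_le_TT' g t t' U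
  set M : ℝ := -(c - A + (∑ σ : Fin 2, μ σ) * (n / 2 - ν)) with hM
  have hM2 : 2 * (c - A + (∑ σ : Fin 2, μ σ) * (n / 2 - ν)) ^ 2 = 2 * M ^ 2 := by rw [hM, neg_sq]
  rw [hM2]
  set useq : ℕ → ℝ := fun k => (∑ x ∈ halfOpenBox 2 (2 * k), ∑ y ∈ halfOpenBox 2 (2 * k),
      torusPullback (pairFieldCorr g ψ) (2 * k) x y) / ((#(halfOpenBox 2 (2 * k)) : ℝ)) ^ 2 with huseq
  change liminf useq atTop ≤ 2 * M ^ 2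
  -- the LRO quantity at side `m + 1`
  set vseq : ℕ → ℝ := fun m =>
    (expect ((pairField g (m + 1))ᴴ * pairField g (m + 1)) (ψ (m + 1))).re / (((m + 1 : ℕ) : ℝ)) ^ 4
    with hvseq
  -- the `k`-th term (for `k ≥ 1`) is `Re⟨ψ_{2k}, Δ†Δ ψ_{2k}⟩ / (2k)⁴`
  have hterm : ∀ k : ℕ, 1 ≤ k → ∃ m : ℕ, 2 * k = m + 1 ∧ useq k = vseq m := by
    intro k hk
    obtain ⟨m, hm⟩ : ∃ m, 2 * k = m + 1 := ⟨2 * k - 1, by omega⟩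
    refine ⟨m, hm, ?_⟩
    simp only [huseq, hvseq]
    rw [hm, torusLROSeq_pairFieldCorr_succ]
  have hvnonneg : ∀ m : ℕ, 0 ≤ vseq m := fun m => by
    simp only [hvseq]
    refine div_nonneg ?_ (by positivity)
    exact (Complex.nonneg_iff.1
      ((Matrix.posSemidef_conjTranspose_mul_self (pairField g (m + 1))).dotProduct_mulVec_nonneg
        (ψ (m + 1)))).1
  have hnonneg : ∀ k : ℕ, 1 ≤ k → 0 ≤ useq k := fun k hk => by
    obtain ⟨m, -, heq⟩ := hterm k hk
    rw [heq]
    exact hvnonneg m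
  have hbdd : IsBoundedUnder (· ≥ ·) atTop useq :=
    isBoundedUnder_of_eventually_ge (a := 0) (Filter.eventually_atTop.2 ⟨1, fun k hk => hnonneg k hk⟩)
  by_contra hcon
  rw [not_le] at hcon
  obtain ⟨c₀, hc₀M, hc₀lim⟩ := exists_between hcon
  have hc₀ : 0 < c₀ := lt_of_le_of_lt (by positivity) hc₀M
  have hev : ∀ᶠ k : ℕ in atTop, c₀ < useq k := eventually_lt_of_lt_liminf hc₀lim hbdd
  -- the comparison sequences
  set K : ℝ := ((∑ σ : Fin 2, |μ σ|) * Cγ / 2 + κ * Cδ / 4) / c₀ with hK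
  set Lr : ℕ → ℝ := fun k => ((2 * k : ℕ) : ℝ) with hLr
  set Eseq : ℕ → ℝ := fun k =>
    groundEnergy (hubbardTorusTT' (2 * k) t t' U) (rectN n (2 * k)) / ((2 * k : ℕ) : ℝ) ^ 2 with hEseq
  set Nseq : ℕ → ℝ := fun k => (rectN n (2 * k) : ℝ) / ((2 * k : ℕ) : ℝ) ^ 2 with hNseq
  set lhs : ℕ → ℝ := fun k => Real.sqrt (2 * c₀ - Cγ / Lr k ^ 2) / 2 with hlhs
  set rhs : ℕ → ℝ := fun k =>
    -(c - A + (∑ σ : Fin 2, μ σ) * (Nseq k / 2 - ν) + κ * (u - Eseq k)) + K / Lr k ^ 4 with hrhs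
  -- the finite-volume step, eventually in `k`
  have hstep : ∀ᶠ k : ℕ in atTop, lhs k ≤ rhs k := by
    filter_upwards [hev, Filter.eventually_ge_atTop (max 1 (max L₁ (max Lγ Lδ)))] with k hk hkL
    have hk1 : 1 ≤ k := le_trans (le_max_left _ _) hkL
    have hkL₁ : L₁ ≤ k := le_trans (le_trans (le_max_left _ _) (le_max_right _ _)) hkL
    have hkγ : Lγ ≤ k :=
      le_trans (le_trans (le_trans (le_max_left _ _) (le_max_right _ _)) (le_max_right _ _)) hkL
    have hkδ : Lδ ≤ k :=
      le_trans (le_trans (le_trans (le_max_right _ _) (le_max_right _ _)) (le_max_right _ _)) hkL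
    obtain ⟨m, hm, heq⟩ := hterm k hk1
    have hmL₁ : L₁ ≤ m + 1 := by omega
    have hmγ : Lγ ≤ m + 1 := by omega
    have hmδ : Lδ ≤ m + 1 := by omega
    have hlro : c₀ * (((m + 1 : ℕ) : ℝ)) ^ 4 ≤
        (expect ((pairField g (m + 1))ᴴ * pairField g (m + 1)) (ψ (m + 1))).re := by
      have h := hk.le
      rw [heq] at h
      simp only [hvseq] at h
      rwa [le_div_iff₀ (by positivity)] at h
    have h := onePoint_finite_step_TT' g t t' U (hψ1 (m + 1)) (hψ (m + 1)) μ hκ hc₀ hCγ hCδ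
      (hγ (m + 1) hmγ _ (hψ1 _)) (hδ (m + 1) hmδ _ (hψ1 _)) hlro (hbound (m + 1) hmL₁)
    -- identify `minEnergyOn` with the sector ground-state energy
    have hcard : ⌊n * (((m + 1 : ℕ)) : ℝ) ^ 2 / 2⌋₊ ≤ Fintype.card (FermionTorus 2 (m + 1)) := by
      rw [show Fintype.card (FermionTorus 2 (m + 1)) = (m + 1) ^ 2 by simp]
      have h2 := rectN_le_two_mul hn0 hn2.le (m + 1)
      simp only [rectN] at h2
      have e : (m + 1) ^ 2 = (m + 1) * (m + 1) := by ring
      rw [e]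
      exact Nat.le_of_mul_le_mul_left h2 (by norm_num)
    have hE : (hubbardTorusTT' (m + 1) t t' U).minEnergyOn (szSector (rectN n (m + 1)) 0) =
        groundEnergy (hubbardTorusTT' (m + 1) t t' U) (rectN n (m + 1)) := by
      simp only [rectN]
      rw [groundEnergy_hubbardTorusTT'_eq_minEnergyOn_szSector (m + 1) t t' U hcard]
    rw [hE, ← hK] at h
    have e1 : ((rectN n (m + 1) : ℕ) : ℝ) / 2 / (((m + 1 : ℕ) : ℝ)) ^ 2 =
        ((rectN n (m + 1) : ℕ) : ℝ) / (((m + 1 : ℕ) : ℝ)) ^ 2 / 2 := div_right_comm _ _ _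
    rw [e1] at h
    simp only [hlhs, hrhs, hLr, hNseq, hEseq]
    rw [hm]
    exact h
  -- limits of the two sides
  have h2k : Tendsto (fun k : ℕ => 2 * k) atTop atTop := Filter.tendsto_id.const_mul_atTop' (by norm_num)
  have hLr_top : Tendsto Lr atTop atTop := tendsto_natCast_atTop_atTop.comp h2k
  have hLr2 : Tendsto (fun k => (Lr k ^ 2)⁻¹) atTop (𝓝 0) :=
    ((tendsto_pow_atTop (α := ℝ) two_ne_zero).comp hLr_top).inv_tendsto_atTop
  have hLr4 : Tendsto (fun k => (Lr k ^ 4)⁻¹) atTop (𝓝 0) :=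
    ((tendsto_pow_atTop (α := ℝ) (by norm_num : (4 : ℕ) ≠ 0)).comp hLr_top).inv_tendsto_atTop
  have hlhs_lim : Tendsto lhs atTop (𝓝 (Real.sqrt (2 * c₀) / 2)) := by
    have h1 : Tendsto (fun k => 2 * c₀ - Cγ * (Lr k ^ 2)⁻¹) atTop (𝓝 (2 * c₀ - Cγ * 0)) :=
      tendsto_const_nhds.sub (hLr2.const_mul Cγ)
    rw [mul_zero, sub_zero] at h1
    have h2 := (h1.sqrt).div_const 2
    refine h2.congr' (Eventually.of_forall fun k => ?_)
    simp [hlhs, div_eq_mul_inv]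
  have hE_lim : Tendsto Eseq atTop (𝓝 (energyDensityTT' t t' U n)) :=
    (tendsto_energyDensityTT'_torus t t' hU hn0 hn2).comp h2k
  have hN_lim : Tendsto Nseq atTop (𝓝 n) := (tendsto_rectN_div_sq hn0).comp h2k
  have hrhs_lim : Tendsto rhs atTop
      (𝓝 (-(c - A + (∑ σ : Fin 2, μ σ) * (n / 2 - ν) + κ * (u - energyDensityTT' t t' U n)) + K * 0)) := by
    have h1 : Tendsto (fun k => -(c - A + (∑ σ : Fin 2, μ σ) * (Nseq k / 2 - ν) + κ * (u - Eseq k)))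
        atTop (𝓝 (-(c - A + (∑ σ : Fin 2, μ σ) * (n / 2 - ν) + κ * (u - energyDensityTT' t t' U n)))) :=
      ((tendsto_const_nhds.add (((hN_lim.div_const 2).sub tendsto_const_nhds).const_mul _)).add
        ((tendsto_const_nhds.sub hE_lim).const_mul κ)).neg
    have h2 := h1.add (hLr4.const_mul K)
    refine h2.congr' (Eventually.of_forall fun k => ?_)
    simp [hrhs, div_eq_mul_inv]
  have hle := le_of_tendsto_of_tendsto hlhs_lim hrhs_lim hstep
  rw [mul_zero, add_zero] at hle
  have hslack : 0 ≤ κ * (u - energyDensityTT' t t' U n) := mul_nonneg hκ (sub_nonneg.2 hu)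
  have hsqM : Real.sqrt (2 * c₀) ≤ 2 * M := by linarith [hM, hle, hslack]
  have hsq : 2 * c₀ ≤ (2 * M) ^ 2 := by
    have h := pow_le_pow_left₀ (Real.sqrt_nonneg _) hsqM 2
    rwa [Real.sq_sqrt (by linarith)] at h
  nlinarith

/-- **Orbit-state form, `t–t'` model.** As `liminf_pairFieldLRO_le_of_onePoint_orbitState_bound` with
`H_L = hubbardTorusTT' L t t' U` and the cap `e(t, t', U, n) ≤ u`. [cite: KomaTasaki1994, Theorem 2.2]
[cite: BratteliRobinsonII1997, §6.2.4] -/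
theorem liminf_pairFieldLRO_le_of_onePoint_orbitState_bound_TT' (t t' : ℝ) {U n : ℝ} (hU : 0 ≤ U)
    (hn0 : 0 ≤ n) (hn2 : n < 2) {c A κ u ν : ℝ} (μ : Fin 2 → ℝ) (hκ : 0 ≤ κ)
    (hu : energyDensityTT' t t' U n ≤ u)
    {S : Finset (DihedralGroup 4)} (hS : S.Nonempty)
    (hg : ∀ γ ∈ S, ∀ e ∈ insert (0 : Site 2) unitSteps, g (d4Vec γ e) = g e)
    {Λ' : Finset (Site 2)} (h0 : pairRegion (insert (0 : Site 2) unitSteps) 0 ⊆ Λ') (L₁ : ℕ)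
    (hInj : ∀ L : ℕ, L₁ ≤ L → Set.InjOn (Torus.proj (d := 2) L) ↑Λ')
    (hbound : ∀ (L : ℕ) [NeZero L] (hL : L₁ ≤ L) (ζ : Fock (Orb (FermionTorus 2 L))), star ζ ⬝ᵥ ζ = 1 →
      c - A + ∑ σ : Fin 2, μ σ *
          ((star ζ ⬝ᵥ ((∑ y : FermionTorus 2 L, numberOp y σ) *ᵥ ζ)).re / (L : ℝ) ^ 2 - ν) +
        κ * (u - (star ζ ⬝ᵥ (hubbardTorusTT' L t t' U *ᵥ ζ)).re / (L : ℝ) ^ 2) ≤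
        (orbitState (spaceGroupUnitary S) ζ (fermionEmbed (PolySite.toTorusEmb L (hInj L hL))
          (-(fermionEmbed (PolySite.incl h0) (localPairAt (insert (0 : Site 2) unitSteps) g 0))))).re)
    (ψ : ∀ L, Fock (Orb (FermionTorus 2 L)))
    (hψ : ∀ L, IsGroundStateInSector (hubbardTorusTT' L t t' U) (rectN n L) 0 (ψ L))
    (hψ1 : ∀ L, star (ψ L) ⬝ᵥ ψ L = 1) :
    liminf (fun k : ℕ => (∑ x ∈ halfOpenBox 2 (2 * k), ∑ y ∈ halfOpenBox 2 (2 * k),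
        torusPullback (pairFieldCorr g ψ) (2 * k) x y) / ((#(halfOpenBox 2 (2 * k)) : ℝ)) ^ 2) atTop ≤
      2 * (c - A + (∑ σ : Fin 2, μ σ) * (n / 2 - ν)) ^ 2 := by
  refine liminf_pairFieldLRO_le_of_onePoint_variational_bound_TT' g t t' hU hn0 hn2 μ hκ hu L₁ ?_ ψ hψ hψ1
  intro L _ hL ζ hζ
  have h := hbound L hL ζ hζ
  rwa [fermionEmbed_neg, map_neg, Complex.neg_re,
    re_orbitState_spaceGroupUnitary_localPairAt g hS hg h0 (hInj L hL) ζ] at h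

/-- **OP1-E window certificate ⇒ `liminf_k u_k ≤ 2M²`, `t–t'` model.** As
`liminf_pairFieldLRO_le_of_onePoint_variational_certificate` with the local energy `E^{t,t'}_Φ` in the
identity, ground states of `hubbardTorusTT' L t t' U`, and the cap `e(t, t', U, n) ≤ u`.
[cite: KomaTasaki1994, Theorem 2.2] [cite: WangEtAl2024, §III] [cite: Han2020Bootstrap, §3] -/
theorem liminf_pairFieldLRO_le_of_onePoint_variational_certificate_TT' (t t' : ℝ) {U n : ℝ} (hU : 0 ≤ U)
    (hn0 : 0 ≤ n) (hn2 : n < 2) {κ u : ℝ} (hκ : 0 ≤ κ) (hu : energyDensityTT' t t' U n ≤ u)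
    {Λ Λ' : Finset (Site 2)} (hΛ : Λ ⊆ Λ')
    (h0 : thicken ({0} : Finset (Site 2)) 1 ⊆ Λ') (hz : (0 : Site 2) ∈ Λ')
    (hP : pairRegion (insert (0 : Site 2) unitSteps) 0 ⊆ Λ')
    {S : Finset (DihedralGroup 4)} (h1 : (1 : DihedralGroup 4) ∈ S) (hmul : ∀ a ∈ S, ∀ b ∈ S, a * b ∈ S)
    (hg : ∀ γ ∈ S, ∀ e ∈ insert (0 : Site 2) unitSteps, g (d4Vec γ e) = g e)
    (μ : Fin 2 → ℝ) (ν : ℝ)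
    {m : Type*} [Fintype m] [DecidableEq m] {Λm : Matrix m m ℂ} (hΛm : Λm.PosSemidef)
    (O : m → FermionOp Λ')
    {ι : Type*} (tt : Finset ι) (γ : ι → DihedralGroup 4) (hγS : ∀ l ∈ tt, γ l ∈ S) (wv : ι → Site 2)
    (hsh : ∀ l, d4ShiftSet (γ l) (wv l) Λ ⊆ Λ') (Y : ι → FermionOp Λ)
    {δ : Type*} (ah : Finset δ) (dc : δ → ℝ) (V : δ → FermionOp Λ')
    {κ'' : Type*} (w : Finset κ'') (a : κ'' → ℂ) (word : κ'' → List (Orb (PolySite Λ') × Bool)) {c : ℝ}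
    (hcert : -(fermionEmbed (PolySite.incl hP) (localPairAt (insert (0 : Site 2) unitSteps) g 0)) -
        (c : ℂ) • (1 : FermionOp Λ') -
        ∑ σ : Fin 2, ((μ σ : ℝ) : ℂ) • (nAt 0 hz σ - ((ν : ℝ) : ℂ) • (1 : FermionOp Λ')) -
        ((κ : ℝ) : ℂ) • (((u : ℝ) : ℂ) • (1 : FermionOp Λ') -
          fermionEmbed (PolySite.incl h0) ((hubbardTTPrimeFermionInteraction t t' U).meanEnergyObs 1)) =
      gramForm Λm O +
        ∑ l ∈ tt, (fermionEmbed (PolySite.incl (hsh l)) (fermionEmbed (PolySite.d4Emb (γ l) (wv l) Λ) (Y l)) -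
            fermionEmbed (PolySite.incl hΛ) (Y l)) +
        (∑ m' ∈ ah, ((dc m' : ℝ) : ℂ) • ((V m')ᴴ - V m') + ∑ k ∈ w, a k • ladderWord (word k)))
    (ψ : ∀ L, Fock (Orb (FermionTorus 2 L)))
    (hψ : ∀ L, IsGroundStateInSector (hubbardTorusTT' L t t' U) (rectN n L) 0 (ψ L))
    (hψ1 : ∀ L, star (ψ L) ⬝ᵥ ψ L = 1) :
    liminf (fun k : ℕ => (∑ x ∈ halfOpenBox 2 (2 * k), ∑ y ∈ halfOpenBox 2 (2 * k),
        torusPullback (pairFieldCorr g ψ) (2 * k) x y) / ((#(halfOpenBox 2 (2 * k)) : ℝ)) ^ 2) atTop ≤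
      2 * (c - ∑ k ∈ w, ‖a k‖ + (∑ σ : Fin 2, μ σ) * (n / 2 - ν)) ^ 2 := by
  obtain ⟨L₀, hL₀⟩ := exists_forall_le_injOn_proj (d := 2) Λ'
  have hInj : ∀ L : ℕ, max L₀ 3 ≤ L → Set.InjOn (Torus.proj (d := 2) L) ↑Λ' :=
    fun L hL => hL₀ L (le_trans (le_max_left _ _) hL)
  refine liminf_pairFieldLRO_le_of_onePoint_orbitState_bound_TT' g t t' hU hn0 hn2 μ hκ hu ⟨1, h1⟩ hg hP
    (max L₀ 3) hInj ?_ ψ hψ hψ1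
  intro L _ hL ζ hζ
  have hL3 : 3 ≤ L := le_trans (le_max_right _ _) hL
  exact re_orbitState_ge_of_window_variational_certificate_d4_TT'_ineq t t' U hL3 hΛ h0 hz (hInj L hL)
    h1 hmul hζ (-(fermionEmbed (PolySite.incl hP) (localPairAt (insert (0 : Site 2) unitSteps) g 0)))
    κ u μ ν hΛm O tt γ hγS wv hsh Y ah dc V w a word hcert

/-- **The registry-style reading at the M3 points `(U, n) = (8, 7/8)`, any `t'`.** A point group `S ∋ 1`
closed under multiplication with `b1gSign = 1` on `S`; a window `Λ'` as above; the OP1-E identity for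
`X = −Γ(incl) Φ₀` (d-wave) with the local energy `E^{1,tp}_Φ` and `Λm ⪰ 0`; `κ ≥ 0`; the cap node
`M3EnergyUpperRow tp hi`, `hi ≤ u`; `2(c − Σ‖a_k‖ + (Σ_σ μ_σ)(7/16 − ν))² ≤ c'`. Then every family `ψ_L`
of unit `(rectN (7/8) L, S^z = 0)`-sector ground states of `hubbardTorusTT' L 1 tp 8` has
`liminf_k |Λ_{2k}|⁻² Σ_{x,y} P_d(2k; x, y) ≤ c'` (at `tp = 0` this is `M3ObsPairLROCeilingAt_tp0 c'`;
at `tp = −1/4` it is the one-point reading at the STEP-0 anchor A0). [cite: KomaTasaki1994, Theorem 2.2]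
[cite: WangEtAl2024, §III] -/
theorem dWavePairLRO_liminf_le_of_onePoint_variational_certificate_M3 {tp : ℝ} {hi c' : ℚ}
    (hE : M3EnergyUpperRow tp hi) {κ u : ℝ} (hκ : 0 ≤ κ) (hhi : ((hi : ℚ) : ℝ) ≤ u)
    {Λ Λ' : Finset (Site 2)} (hΛ : Λ ⊆ Λ')
    (h0 : thicken ({0} : Finset (Site 2)) 1 ⊆ Λ') (hz : (0 : Site 2) ∈ Λ')
    (hP : pairRegion (insert (0 : Site 2) unitSteps) 0 ⊆ Λ')
    {S : Finset (DihedralGroup 4)} (h1 : (1 : DihedralGroup 4) ∈ S) (hmul : ∀ a ∈ S, ∀ b ∈ S, a * b ∈ S)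
    (hS1 : ∀ γ ∈ S, b1gSign γ = 1)
    (μ : Fin 2 → ℝ) (ν : ℝ)
    {m : Type*} [Fintype m] [DecidableEq m] {Λm : Matrix m m ℂ} (hΛm : Λm.PosSemidef)
    (O : m → FermionOp Λ')
    {ι : Type*} (tt : Finset ι) (γ : ι → DihedralGroup 4) (hγS : ∀ l ∈ tt, γ l ∈ S) (wv : ι → Site 2)
    (hsh : ∀ l, d4ShiftSet (γ l) (wv l) Λ ⊆ Λ') (Y : ι → FermionOp Λ)
    {δ : Type*} (ah : Finset δ) (dc : δ → ℝ) (V : δ → FermionOp Λ')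
    {κ'' : Type*} (w : Finset κ'') (a : κ'' → ℂ) (word : κ'' → List (Orb (PolySite Λ') × Bool)) {c : ℝ}
    (hcert : -(fermionEmbed (PolySite.incl hP) (localPairAt (insert (0 : Site 2) unitSteps) dWaveFormFactor 0)) -
        (c : ℂ) • (1 : FermionOp Λ') -
        ∑ σ : Fin 2, ((μ σ : ℝ) : ℂ) • (nAt 0 hz σ - ((ν : ℝ) : ℂ) • (1 : FermionOp Λ')) -
        ((κ : ℝ) : ℂ) • (((u : ℝ) : ℂ) • (1 : FermionOp Λ') -
          fermionEmbed (PolySite.incl h0) ((hubbardTTPrimeFermionInteraction 1 tp 8).meanEnergyObs 1)) =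
      gramForm Λm O +
        ∑ l ∈ tt, (fermionEmbed (PolySite.incl (hsh l)) (fermionEmbed (PolySite.d4Emb (γ l) (wv l) Λ) (Y l)) -
            fermionEmbed (PolySite.incl hΛ) (Y l)) +
        (∑ m' ∈ ah, ((dc m' : ℝ) : ℂ) • ((V m')ᴴ - V m') + ∑ k ∈ w, a k • ladderWord (word k)))
    (hc' : 2 * (c - ∑ k ∈ w, ‖a k‖ + (∑ σ : Fin 2, μ σ) * ((7 / 8 : ℝ) / 2 - ν)) ^ 2 ≤ ((c' : ℚ) : ℝ))
    (ψ : ∀ L, Fock (Orb (FermionTorus 2 L)))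
    (hψ : ∀ L, IsGroundStateInSector (hubbardTorusTT' L 1 tp 8) (rectN (7 / 8) L) 0 (ψ L))
    (hψ1 : ∀ L, star (ψ L) ⬝ᵥ ψ L = 1) :
    liminf (fun k : ℕ => (∑ x ∈ halfOpenBox 2 (2 * k), ∑ y ∈ halfOpenBox 2 (2 * k),
        torusPullback (pairFieldCorr dWaveFormFactor ψ) (2 * k) x y) /
          ((#(halfOpenBox 2 (2 * k)) : ℝ)) ^ 2) atTop ≤ ((c' : ℚ) : ℝ) := by
  have hu : energyDensityTT' 1 tp 8 (7 / 8) ≤ u :=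
    (show energyDensityTT' 1 tp 8 (7 / 8) ≤ ((hi : ℚ) : ℝ) from hE).trans hhi
  have hg : ∀ γ ∈ S, ∀ e ∈ insert (0 : Site 2) unitSteps, dWaveFormFactor (d4Vec γ e) = dWaveFormFactor e :=
    fun γ hγ e _ => dWaveFormFactor_d4Vec_of_b1gSign_eq_one (hS1 γ hγ) e
  exact (liminf_pairFieldLRO_le_of_onePoint_variational_certificate_TT' dWaveFormFactor 1 tp (by norm_num)
    (by norm_num) (by norm_num) hκ hu hΛ h0 hz hP h1 hmul hg μ ν hΛm O tt γ hγS wv hsh Y ah dc V w a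
    word hcert ψ hψ hψ1).trans hc'

end Family

end Summit.Ventures.CertifiedManyBodySolver.Observables

end
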